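import Summits.MatrixMultiplication.MatrixMultiplication.Theorems.SaturationLadderHeightExcess
import HarnessLib

/-!
# Route `SaturationLadder` on Strassen's spectrum, XIII: the two GRADES of a thin clause (typed leaf)

decomp-mm lens 1 «grading / quantitative ladder», gen 47, kernel K47-G (chain file 13, companion of file 12
`SaturationLadderHeightExcess`).  Sorry-free support beneath the deciding crux `SubexpSaturation`
(stmt-MatrixMultiplication-25909) of `route-MatrixMultiplication-SaturationLadder`; cut of record UNCHANGED:
`closes (h₁ : SubexpSaturation) (h₂ : SubexpToPoly) (h₃ : PolyToFinite) (h₄ : TailDescentTwo) (h₅ : SquareFromTwo)`.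

This file NAMES the quantitative ladder below the crux that files 9–12 proved rung by rung, as two one-parameter
families of propositions over a field `K` (rate `c > 0`, exponent `A`; `R = e^{c/(1−t)}`, `s = 1−t`):
* `HeightClause K c A` — eventually in `t → 1⁻`, the roof of the thin clause `(t,R)` holds at every universal
  spectral point of HEIGHT `θ₁ ≥ R^{−A}`;
* `ThinExcessBound K c A` — eventually in `t → 1⁻`, the THIN EXCESS `e(t,R) = ω(1,t,R) − (1+R)` is `≤ R^{−A}`.
They are two readings of ONE grade (file 12's duality): `HeightClause c A ⟹ ThinExcessBound c A`
(`thinExcessBound_of_heightClause`) and `ThinExcessBound c' A' ⟹ HeightClause c A` for all `c' < c`, `A < A'`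
(`heightClause_of_thinExcessBound`); both are antitone in `A`.  On this ladder:
* the crux is the top, `A = ∞`: `SubexpSaturation ⟺` the thin excess VANISHES eventually along every curve
  `R = e^{c/(1−t)}` (`subexpSaturation_iff_excessZero`), hence `⟹ HeightClause ℂ c A ∧ ThinExcessBound ℂ c A` for
  all `c > 0`, `A` (`grades_of_subexpSaturation`); over `ℂ` every rung with `c > c₂ = (5 log(5/4)+3 log 2)/3` is a
  THEOREM (`excessZero_above_classCeiling`, file 3's corner roof);
* `RateBeyond θ ⟹ HeightClause K c θ ∧ ThinExcessBound K c θ` for every `c > 0` (`grades_of_rateBeyond`, file 9), so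
  after route `FarEdgeDescent`'s kernel XXXII-D (`rateBeyond_isolatedTower`) EVERY RUNG `A < θ_S = log(4/3)/log(3/2)
  = 0.70951…` IS A THEOREM over every field (`grades_isolatedTower`).
THE TYPED LEAF of the lineage's tree (gen 47): **OPEN(c, A) := `HeightClause ℂ c A` for `0 < c ≤ c₂`, `A ≥ θ_S`**,
and by `heightClause_of_thinExcessBound` it is fed by ANY thin-excess certificate `ThinExcessBound ℂ c' A'` with
`c' < c`, `A' > A` — a statement about the exponent `ω` alone ("a rectangular algorithm for `⟨n, n^{1−s}, n^{R}⟩`,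
`R = e^{c'/s}`, of exponent `≤ 1 + R + R^{−A'}`"), testable on every laser-method design.  An arithmetic lemma
`exp_neg_div_le` (`e^{−a/s} ≤ b·s` for `s ≤ a²b/4`) carries the change of exponent.
Definitions of this file are problem-side vocabulary for the lineage's memos (gate rule D-0009: two `def`s, no
instances, no notation); nothing here proves `ω = 2` or an open item.  [cite: Strassen1988, Thm. 3.8]
[cite: LottiRomani1983, Thm. 2; Prop. 4.1] [cite: Pan1984, Thm. 17.1] [cite: CoppersmithWinograd1990, §8]
[cite: AlmanLi2026, Proposition 4.2]
-/

set_option linter.dupNamespace false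

noncomputable section

namespace Summit.MatrixMultiplication.MatrixMultiplication.Theorems.SaturationLadderHeightGrades

open Literature.Computability.AlgebraicComplexity
open Summit.MatrixMultiplication.MatrixMultiplication.Theses.SaturationLadder
open Summit.MatrixMultiplication.MatrixMultiplication.Theorems.SaturationLadderCornerGerm
  (subexpSaturation_iff_roof cornerRoof_above_classCeiling)
open Summit.MatrixMultiplication.MatrixMultiplication.Theorems.SaturationLadderHeightCeiling
  (heightCeiling_of_rateBeyond)
open Summit.MatrixMultiplication.MatrixMultiplication.Theorems.SaturationLadderHeightExcess
  (excess_le_of_roofAbove height_lt_excess excess_eq_zero_iff_roof)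
open Summit.MatrixMultiplication.MatrixMultiplication.Theorems.FarEdgeDescentIsolatedTower (rateBeyond_isolatedTower)

section Grades

variable (K : Type) [Field K]

/-- **GRADE `A` IN HEIGHT CURRENCY — the height clause of rate `c` at exponent `A`**: there is `t₀ < 1` such that
for all `t ∈ [t₀,1)` and every universal spectral point `φ` over `K` of height `θ₁ ≥ exp(−A·c/(1−t)) = R^{−A}`,
the roof of the thin clause `(t, R = e^{c/(1−t)})` holds: `t·θ₁ ≤ (1−θ₀) + R·(1−θ₂)`.  (`A = ∞`, i.e. no height
restriction, is the spectral form of `SubexpSaturation` at rate `c`, file 3's `subexpSaturation_iff_roof`.)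
[cite: Strassen1988, Thm. 3.8] [cite: AlmanLi2026, Proposition 4.2] -/
def HeightClause (c A : ℝ) : Prop :=
  ∃ t₀ : ℝ, t₀ < 1 ∧ ∀ t : ℝ, t₀ ≤ t → t < 1 → ∀ F : SpectralMap K, IsUniversalSpectralPoint K F →
    Real.exp (-(A * c / (1 - t))) ≤ specMMPoint K F 1 →
      t * specMMPoint K F 1 ≤ (1 - specMMPoint K F 0) + Real.exp (c / (1 - t)) * (1 - specMMPoint K F 2)

/-- **GRADE `A` IN EXPONENT CURRENCY — the thin-excess bound of rate `c` at exponent `A`**: there is `t₀ < 1` such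
that for all `t ∈ [t₀,1)`, with `R = e^{c/(1−t)}`: `ω_K(1,t,R) − (1+R) ≤ R^{−A} = exp(−A·c/(1−t))` — a rectangular
upper bound with a sub-unit additive defect. [cite: LottiRomani1983, Thm. 2] -/
def ThinExcessBound (c A : ℝ) : Prop :=
  ∃ t₀ : ℝ, t₀ < 1 ∧ ∀ t : ℝ, t₀ ≤ t → t < 1 →
    omegaRect K 1 t (Real.exp (c / (1 - t))) - (1 + Real.exp (c / (1 - t))) ≤ Real.exp (-(A * c / (1 - t)))

end Grades

variable {K : Type} [Field K]

/-! ## §1 The two grades are one (duality of file 12), and both are antitone in `A` -/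

/-- Both grades are ANTITONE in the exponent: `A ≤ A' ⟹ HeightClause c A' ⟹ HeightClause c A` (`c ≥ 0`).
[folklore] -/
theorem heightClause_of_le {c A A' : ℝ} (hc : 0 ≤ c) (hAA : A ≤ A') (h : HeightClause K c A') :
    HeightClause K c A := by
  obtain ⟨t₀, ht₀, h⟩ := h
  refine ⟨t₀, ht₀, fun t ht ht1 F hF hh => h t ht ht1 F hF (le_trans (Real.exp_le_exp.2 ?_) hh)⟩
  have hs : 0 < 1 - t := by linarith
  have : A * c / (1 - t) ≤ A' * c / (1 - t) :=
    div_le_div_of_nonneg_right (mul_le_mul_of_nonneg_right hAA hc) hs.le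
  linarith

/-- `A ≤ A' ⟹ ThinExcessBound c A' ⟹ ThinExcessBound c A` (`c ≥ 0`). [folklore] -/
theorem thinExcessBound_of_le {c A A' : ℝ} (hc : 0 ≤ c) (hAA : A ≤ A') (h : ThinExcessBound K c A') :
    ThinExcessBound K c A := by
  obtain ⟨t₀, ht₀, h⟩ := h
  refine ⟨t₀, ht₀, fun t ht ht1 => le_trans (h t ht ht1) (Real.exp_le_exp.2 ?_)⟩
  have hs : 0 < 1 - t := by linarith
  have : A * c / (1 - t) ≤ A' * c / (1 - t) :=
    div_le_div_of_nonneg_right (mul_le_mul_of_nonneg_right hAA hc) hs.le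
  linarith

/-- ★ **HEIGHT ⟹ EXCESS at the same grade**: `HeightClause K c A ⟹ ThinExcessBound K c A`: if the roof
`(t,R)` holds above height `H = R^{−A}` then `e(t,R) ≤ t·H ≤ H` (file 12's `excess_le_of_roofAbove`).
[cite: Strassen1988, Thm. 3.8] -/
theorem thinExcessBound_of_heightClause {c A : ℝ} (h : HeightClause K c A) : ThinExcessBound K c A := by
  obtain ⟨t₀, ht₀, h⟩ := h
  refine ⟨max t₀ 0, max_lt ht₀ one_pos, fun t ht ht1 => ?_⟩
  have ht0 : 0 ≤ t := le_trans (le_max_right _ _) ht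
  have hH : 0 ≤ Real.exp (-(A * c / (1 - t))) := (Real.exp_pos _).le
  have h1 := excess_le_of_roofAbove ht0 (Real.exp_pos (c / (1 - t))).le hH
    (fun F hF hh => h t (le_trans (le_max_left _ _) ht) ht1 F hF hh)
  have h2 : t * Real.exp (-(A * c / (1 - t))) ≤ Real.exp (-(A * c / (1 - t))) := by
    have := mul_le_mul_of_nonneg_right ht1.le hH
    rwa [one_mul] at this
  exact le_trans h1 h2

/-- Arithmetic of the exponent change: for `a > 0` and `0 < s ≤ a²b/4`, `e^{−a/s} ≤ b·s`
(`e^{a/s} = (e^{a/(2s)})² ≥ (a/(2s))²`). [folklore] -/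
theorem exp_neg_div_le {a b s : ℝ} (ha : 0 < a) (hs : 0 < s) (hs₀ : s ≤ a ^ 2 * b / 4) :
    Real.exp (-(a / s)) ≤ b * s := by
  have h2 : 0 < a / (2 * s) := by positivity
  have h1 : a / (2 * s) + 1 ≤ Real.exp (a / (2 * s)) := Real.add_one_le_exp _
  have h3 : (a / (2 * s)) ^ 2 ≤ Real.exp (a / s) := by
    have e : Real.exp (a / s) = Real.exp (a / (2 * s)) ^ 2 := by
      rw [sq, ← Real.exp_add]
      congr 1
      field_simp
      ring
    rw [e]
    exact pow_le_pow_left₀ h2.le (by linarith) 2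
  have h4 : (a / (2 * s)) ^ 2 = a ^ 2 / (4 * s ^ 2) := by
    field_simp
    ring
  rw [h4] at h3
  have h5 : 0 < a ^ 2 / (4 * s ^ 2) := by positivity
  have h6 : s * s ≤ s * (a ^ 2 * b / 4) := mul_le_mul_of_nonneg_left hs₀ hs.le
  rw [Real.exp_neg]
  calc (Real.exp (a / s))⁻¹ ≤ (a ^ 2 / (4 * s ^ 2))⁻¹ := inv_anti₀ h5 h3
    _ = 4 * s ^ 2 / a ^ 2 := by rw [inv_div]
    _ ≤ b * s := by
        rw [div_le_iff₀ (by positivity)]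
        nlinarith [h6]

/-- ★★ **EXCESS ⟹ HEIGHT, one notch down in rate and exponent**: `ThinExcessBound K c' A' ⟹ HeightClause K c A`
whenever `0 < c' < c` and `A < A'`.  A violator `φ` of the roof `(t, R = e^{c/(1−t)})` is compared (file 12's
`height_lt_excess`) with the excess at the HEAVIER weight `t' = 1 − (c'/c)(1−t) > t`, where the same length reads
`R = e^{c'/(1−t')}`: `(t'−t)·θ₁ < e(t',R) ≤ R^{−A'}`, `t'−t = (1−c'/c)(1−t)`; a height `θ₁ ≥ R^{−A}` would force
`(1−c'/c)(1−t) < R^{−(A'−A)} = e^{−(A'−A)c/(1−t)}`, false for `t` near `1` (`exp_neg_div_le`).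
[cite: Strassen1988, Thm. 3.8] [cite: LottiRomani1983, Thm. 2] -/
theorem heightClause_of_thinExcessBound {c c' A A' : ℝ} (hc' : 0 < c') (hcc : c' < c) (hA : A < A')
    (h : ThinExcessBound K c' A') : HeightClause K c A := by
  obtain ⟨t₀, ht₀, h⟩ := h
  have hc : 0 < c := lt_trans hc' hcc
  have hcne : c ≠ 0 := hc.ne'
  have hc'ne : c' ≠ 0 := hc'.ne'
  set q : ℝ := c' / c with hq
  have hq0 : 0 < q := div_pos hc' hc
  have hq1 : q < 1 := (div_lt_one hc).2 hcc
  set a : ℝ := (A' - A) * c with ha_def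
  have ha : 0 < a := mul_pos (sub_pos.2 hA) hc
  set b : ℝ := 1 - q with hb_def
  have hb : 0 < b := sub_pos.2 hq1
  set s₀ : ℝ := a ^ 2 * b / 4 with hs₀
  have hs₀pos : 0 < s₀ := by positivity
  refine ⟨max (max t₀ 0) (1 - s₀), max_lt (max_lt ht₀ one_pos) (by linarith), fun t ht ht1 F hF hh => ?_⟩
  have ht₀t : t₀ ≤ t := le_trans (le_trans (le_max_left _ _) (le_max_left _ _)) ht
  have ht0 : 0 ≤ t := le_trans (le_trans (le_max_right _ _) (le_max_left _ _)) ht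
  have hts : 1 - t ≤ s₀ := by
    have := le_trans (le_max_right _ _) ht
    linarith
  have hs : 0 < 1 - t := sub_pos.2 ht1
  have hsne : (1 - t) ≠ 0 := hs.ne'
  -- the heavier comparison weight `t'`
  set t' : ℝ := 1 - q * (1 - t) with ht'
  have h1t' : 1 - t' = q * (1 - t) := by rw [ht']; ring
  have ht'1 : t' < 1 := by
    have := mul_pos hq0 hs
    linarith
  have htt' : t' - t = b * (1 - t) := by rw [ht', hb_def]; ring
  have ht't : t ≤ t' := by
    have := mul_pos hb hs
    linarith
  have ht'0 : 0 ≤ t' := le_trans ht0 ht't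
  have ht₀t' : t₀ ≤ t' := le_trans ht₀t ht't
  have hrate : c' / (1 - t') = c / (1 - t) := by
    rw [h1t', hq]
    field_simp
  have hexp : Real.exp (-(A' * c' / (1 - t'))) = Real.exp (-(A' * c / (1 - t))) := by
    rw [mul_div_assoc, hrate, ← mul_div_assoc]
  have hE := h t' ht₀t' ht'1
  rw [hrate, hexp] at hE
  by_contra hv
  have hlt := height_lt_excess hF ht'0 (Real.exp_pos (c / (1 - t))).le hv
  rw [htt'] at hlt
  have hsmall : Real.exp (-(a / (1 - t))) ≤ b * (1 - t) := exp_neg_div_le ha hs hts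
  have hsplit : Real.exp (-(A' * c / (1 - t))) =
      Real.exp (-(a / (1 - t))) * Real.exp (-(A * c / (1 - t))) := by
    rw [← Real.exp_add]
    congr 1
    rw [ha_def]
    field_simp
    ring
  have hpos : 0 < Real.exp (-(A * c / (1 - t))) := Real.exp_pos _
  have h3 : b * (1 - t) * Real.exp (-(A * c / (1 - t))) ≤ b * (1 - t) * specMMPoint K F 1 :=
    mul_le_mul_of_nonneg_left hh (by positivity)
  have h4 : b * (1 - t) * specMMPoint K F 1 <
      Real.exp (-(a / (1 - t))) * Real.exp (-(A * c / (1 - t))) := by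
    rw [← hsplit]
    linarith
  have h5 : Real.exp (-(a / (1 - t))) * Real.exp (-(A * c / (1 - t))) ≤
      b * (1 - t) * Real.exp (-(A * c / (1 - t))) :=
    mul_le_mul_of_nonneg_right hsmall hpos.le
  linarith

/-! ## §2 The crux is the top of the ladder; the proved rungs -/

/-- ★ **`SubexpSaturation` ⟺ the thin excess VANISHES eventually along every exponential curve** (over `ℂ`):
`∀ c > 0 ∃ t₀ < 1 ∀ t ∈ [t₀,1): ω(1,t,e^{c/(1−t)}) = 1 + e^{c/(1−t)}` (file 3's roof form and file 12's
`excess_eq_zero_iff_roof`). [cite: Strassen1988, Thm. 3.8] [cite: AlmanDuanVassilevskaWilliamsXuXuZhou2025, §3.4] -/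
theorem subexpSaturation_iff_excessZero :
    SubexpSaturation ↔ ∀ c : ℝ, 0 < c → ∃ t₀ : ℝ, t₀ < 1 ∧ ∀ t : ℝ, t₀ ≤ t → t < 1 →
      omegaRect ℂ 1 t (Real.exp (c / (1 - t))) - (1 + Real.exp (c / (1 - t))) = 0 := by
  rw [subexpSaturation_iff_roof]
  refine forall₂_congr fun c _ => ?_
  constructor
  · rintro ⟨t₀, ht₀, h⟩
    refine ⟨max t₀ 0, max_lt ht₀ one_pos, fun t ht ht1 => ?_⟩
    have ht0 : 0 ≤ t := le_trans (le_max_right _ _) ht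
    exact (excess_eq_zero_iff_roof ht0 (Real.exp_pos _).le).2 (h t (le_trans (le_max_left _ _) ht) ht1)
  · rintro ⟨t₀, ht₀, h⟩
    refine ⟨max t₀ 0, max_lt ht₀ one_pos, fun t ht ht1 F hF => ?_⟩
    have ht0 : 0 ≤ t := le_trans (le_max_right _ _) ht
    exact (excess_eq_zero_iff_roof ht0 (Real.exp_pos _).le).1 (h t (le_trans (le_max_left _ _) ht) ht1) F hF

/-- **The crux implies every rung**: `SubexpSaturation ⟹ HeightClause ℂ c A ∧ ThinExcessBound ℂ c A` for all
`c > 0` and all `A`. (The converse fails rung by rung: the ladder's thresholds `t₀(c,A)` need not be uniform in `A`.)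
[cite: Strassen1988, Thm. 3.8] -/
theorem grades_of_subexpSaturation (h : SubexpSaturation) {c : ℝ} (hc : 0 < c) (A : ℝ) :
    HeightClause ℂ c A ∧ ThinExcessBound ℂ c A := by
  have hH : HeightClause ℂ c A := by
    obtain ⟨t₀, ht₀, h0⟩ := (subexpSaturation_iff_roof.1 h) c hc
    exact ⟨t₀, ht₀, fun t ht ht1 F hF _ => h0 t ht ht1 F hF⟩
  exact ⟨hH, thinExcessBound_of_heightClause hH⟩

/-- **Rungs above the class ceiling are theorems** (over `ℂ`): for `c > c₂ = (5 log(5/4) + 3 log 2)/3` the thin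
excess vanishes eventually along `R = e^{c/(1−t)}` (file 3's `cornerRoof_above_classCeiling`), so
`HeightClause ℂ c A ∧ ThinExcessBound ℂ c A` for every `A`. [cite: CoppersmithWinograd1990, §8]
[cite: Strassen1988, Thm. 3.8] -/
theorem grades_above_classCeiling {c : ℝ} (hc : (5 * Real.log (5 / 4) + 3 * Real.log 2) / 3 < c) (A : ℝ) :
    HeightClause ℂ c A ∧ ThinExcessBound ℂ c A := by
  have hH : HeightClause ℂ c A := by
    obtain ⟨t₀, ht₀, h0⟩ := cornerRoof_above_classCeiling c hc
    exact ⟨t₀, ht₀, fun t ht ht1 F hF _ => h0 t ht ht1 F hF⟩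
  exact ⟨hH, thinExcessBound_of_heightClause hH⟩

/-- ★ **`RateBeyond θ` proves the rung `θ` in both currencies** (every field, `θ > 0`, every `c > 0`): file 9's
`heightCeiling_of_rateBeyond` is literally `HeightClause K c θ`, and §1 converts it. [cite: LottiRomani1983, Prop. 4.1]
[cite: Strassen1988, Thm. 3.8] -/
theorem grades_of_rateBeyond {θ : ℝ} (hθ : 0 < θ)
    (hR : ∃ ρ C : ℝ, θ < ρ ∧ ∀ k : ℕ, 1 ≤ k → omegaRect K 1 k 1 - (k + 1) ≤ C * (k : ℝ) ^ (-ρ))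
    {c : ℝ} (hc : 0 < c) : HeightClause K c θ ∧ ThinExcessBound K c θ :=
  have hH : HeightClause K c θ := heightCeiling_of_rateBeyond hθ hR hc
  ⟨hH, thinExcessBound_of_heightClause hH⟩

/-- ★★ **RECORD (gen 47): every rung `A < θ_S = log(4/3)/log(3/2) = 0.70951…` is a THEOREM**, over every field,
for every rate `c > 0`, in both currencies — from route `FarEdgeDescent`'s unconditional `RateBeyond θ`, `θ < θ_S`
(kernel XXXII-D `rateBeyond_isolatedTower`).  The lineage's OPEN LEAF is `HeightClause ℂ c A` for `c ≤ c₂`,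
`A ≥ θ_S`; by `heightClause_of_thinExcessBound` any certificate `ThinExcessBound ℂ c' A'`, `c' < c`, `A' > A`,
closes the rung `(c, A)`. [cite: Pan1984, Thm. 17.1] [cite: LottiRomani1983, Prop. 4.1] [cite: Strassen1988, Thm. 3.8] -/
theorem grades_isolatedTower {A : ℝ} (hA : 0 < A)
    (hAS : A < Real.logb 2 ((4 : ℝ) / 3) / (1 - Real.logb 2 ((4 : ℝ) / 3))) {c : ℝ} (hc : 0 < c) :
    HeightClause K c A ∧ ThinExcessBound K c A :=
  grades_of_rateBeyond hA (rateBeyond_isolatedTower K hAS) hc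

end Summit.MatrixMultiplication.MatrixMultiplication.Theorems.SaturationLadderHeightGrades

end
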